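import Literature.MathematicalPhysics.KineticTheory.InfiniteChainL2LocalityPolynomial
import Literature.MathematicalPhysics.KineticTheory.InfiniteChainSeveredGibbs
import Literature.MathematicalPhysics.KineticTheory.InfiniteChainGibbsInvariance
import Literature.MathematicalPhysics.KineticTheory.InfiniteChainShiftInvariantUniqueness
import Literature.MathematicalPhysics.KineticTheory.InfiniteChainCurrentMoments
import HarnessLib

/-!
# Stub `stub_polynomialHorizonCone` of line `Sketch` (crux `FibreCalculus`, stmt-AtomisticToContinuum-16011)

The POLYNOMIAL-HORIZON WEIGHTED `L²` LIGHT CONE of the canonical Buttà–Marchioro dynamics of the pinned anharmonic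
chain `pinnedChain ω₂ lam β γ` (`ω₂, lam, β > 0`) in a shift-invariant DLR state `μ` at `T > 0`: for every measurable
observable `a` reading the sites `−1, 0, 1`, in `L²` and `L⁴`, polynomially Lipschitz in those coordinates, there are
`A, m` such that for every window `τ ≥ 0` a rate `ε ≥ 0` with `Σ_n (1+n)² ε_n ≤ A(1+τ)^m` controls the `L²(μ)`
distance of `a ∘ φ_t` (`|t| ≤ τ`) to an observable localised in `[−n−1, n+1]`. This is the Literature theorem
`InfiniteChainDynamics.exists_weighted_l2_locality` (BM 2016 §3 with constants kept) instantiated: the shift-invariant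
DLR state is superstable (`hasSuperstabilityEstimate_of_isShiftInvariant_pinnedChain`), the canonical dynamics
preserves it (`preservesMeasure_of_carrier_eq_bmGood`) and so do the severed flows
(`measurePreserving_severedFlow_of_isChainGibbsMeasure`).
-/

noncomputable section

open MeasureTheory ProbabilityTheory Filter Topology Set Function

namespace Summit.AtomisticToContinuum.FouriersLaw.Theorems.FibreCalculusSketch

open Literature.MathematicalPhysics.KineticTheory.HeatConduction

/-- **Stub W1 `stub_polynomialHorizonCone`, PROVED** — the polynomial-horizon weighted `L²` light cone of the
canonical dynamics of the pinned chain in its shift-invariant DLR state (instance of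
`InfiniteChainDynamics.exists_weighted_l2_locality`). [cite: ButtaMarchioro2016, §3 eqs. (3.7), (3.14)–(3.16)] -/
theorem stub_polynomialHorizonCone :
    ∀ ω₂ lam β γ : ℝ, 0 < ω₂ → 0 < lam → 0 < β → ∀ T : ℝ, 0 < T →
    ∀ μ : Measure ChainConfig, (pinnedChain ω₂ lam β γ).IsChainGibbsMeasure T μ → IsShiftInvariant μ →
    ∀ D : InfiniteChainDynamics (pinnedChain ω₂ lam β γ),
    D.carrier = (pinnedChain ω₂ lam β γ).bmGood → (∀ t : ℝ, Measurable (D.flow t)) →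
    ∀ a : ChainConfig → ℝ, Measurable a → DependsOn a (Set.Icc (-1 : ℤ) 1) → MemLp a 2 μ →
    Integrable (fun σ => a σ ^ 4) μ →
    ∀ (Ca : ℝ) (da : ℕ), 0 ≤ Ca →
    (∀ (σ σ' : ChainConfig) (R δ : ℝ), 1 ≤ R → 0 ≤ δ → δ ≤ 1 →
      (∀ i : ℤ, -1 ≤ i → i ≤ 1 → |(σ' i).1| ≤ R ∧ |(σ' i).2| ≤ R ∧
        |(σ i).1 - (σ' i).1| ≤ δ ∧ |(σ i).2 - (σ' i).2| ≤ δ) → |a σ - a σ'| ≤ Ca * R ^ da * δ) →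
    ∃ (A : ℝ) (m : ℕ), ∀ τ : ℝ, 0 ≤ τ → ∃ ε : ℕ → ℝ, (∀ n, 0 ≤ ε n) ∧
      Summable (fun n : ℕ => (1 + (n : ℝ)) ^ 2 * ε n) ∧
      (∑' n : ℕ, (1 + (n : ℝ)) ^ 2 * ε n) ≤ A * (1 + τ) ^ m ∧
      ∀ t : ℝ, |t| ≤ τ → ∀ n : ℕ, ∃ g : ChainConfig → ℝ,
        DependsOn g (Set.Icc (-(n : ℤ) - 1) (n + 1)) ∧ Measurable g ∧ MemLp g 2 μ ∧
        Real.sqrt (∫ σ, (a (D.flow t σ) - g σ) ^ 2 ∂μ) ≤ ε n := by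
  intro ω₂ lam β γ hω hl hβ T hT μ hG hSI D hcar hmeas a ham had ha2 ha4 Ca da hCa hLip
  have hU1 : OscillatorChain.IsEvenPolyOfDegree (pinnedChain ω₂ lam β γ).U 2 :=
    OscillatorChain.pinnedChain_isEvenPolyOfDegree_U β γ hω.le hl
  have hV1 : OscillatorChain.IsEvenPolyOfDegree (pinnedChain ω₂ lam β γ).V 2 :=
    OscillatorChain.pinnedChain_isEvenPolyOfDegree_V ω₂ lam γ hβ
  have hU0 : ∀ r, 0 ≤ (pinnedChain ω₂ lam β γ).U r := OscillatorChain.pinnedChain_U_nonneg β γ hω.le hl.le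
  have hV0 : ∀ r, 0 ≤ (pinnedChain ω₂ lam β γ).V r := hV1.choose_spec.2.2
  have hU : ContDiff ℝ 2 (pinnedChain ω₂ lam β γ).U := hU1.contDiff_two
  have hV : ContDiff ℝ 2 (pinnedChain ω₂ lam β γ).V := hV1.contDiff_two
  have hB1 : (pinnedChain ω₂ lam β γ).CondB1 :=
    OscillatorChain.condB1_of_bddBelow _ hU hV ⟨0, by rintro _ ⟨q, rfl⟩; exact hU0 q⟩
      ⟨0, by rintro _ ⟨r, rfl⟩; exact hV0 r⟩
  have hss : (pinnedChain ω₂ lam β γ).HasSuperstabilityEstimate μ :=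
    OscillatorChain.hasSuperstabilityEstimate_of_isShiftInvariant_pinnedChain γ hω hl.le hβ.le hT hG hSI
  have hD : D.PreservesMeasure μ :=
    OscillatorChain.preservesMeasure_of_carrier_eq_bmGood (by norm_num) (by norm_num) hU1 hV1 D hcar hmeas hG hss
  have hsev : ∀ (n : ℕ) (t : ℝ), MeasurePreserving
      (OscillatorChain.severedFlow hB1 (Finset.Icc ((0 : ℤ) - n) ((0 : ℤ) + n)) t) μ μ := fun n t =>
    OscillatorChain.measurePreserving_severedFlow_of_isChainGibbsMeasure hU hV hB1 _ hG t
  obtain ⟨Atot, m, hmain⟩ := D.exists_weighted_l2_locality (by norm_num) (by norm_num) hU1 hV1 hcar hB1 hss hD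
    hsev ham had ha2 ha4 hCa hLip
  refine ⟨Atot, m, fun τ hτ => ?_⟩
  obtain ⟨ε, hε0, hεs, hεb, happ⟩ := hmain τ hτ
  refine ⟨ε, hε0, hεs, hεb, fun t ht n => ?_⟩
  obtain ⟨h1, h2, h3, h4⟩ := happ t ht n
  exact ⟨_, h1, h2, h3, h4⟩

end Summit.AtomisticToContinuum.FouriersLaw.Theorems.FibreCalculusSketch

end
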